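import Mathlib
import Summits.ResolutionOfSingularities.ResolutionOfSingularities.Theorems.WeightedInvariantLocalWeightedDropNCGameBWinsDefs
import Summits.ResolutionOfSingularities.ResolutionOfSingularities.Theorems.WeightedInvariantLocalWeightedDropSpaceCountGameInvariance
import Summits.ResolutionOfSingularities.ResolutionOfSingularities.Theorems.WeightedInvariantLocalWeightedDropNCTameBinomialEndGame
import Summits.ResolutionOfSingularities.ResolutionOfSingularities.Theorems.WeightedInvariantLocalWeightedDropNCResRegimeLetterAssembly

/-!
# `WeightedInvariant.LocalWeightedDrop` ENGINE, W′|₄ line — D₃ᴮ object (8): A B-WIN FROM A LETTER-PRESERVING TWIST IS A B-WIN (tool for hand B)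

Sub-problem `ResolutionOfSingularities`, ENGINE crux `stmt-ResolutionOfSingularities-8899` (`LocalWeightedDrop`), registered stub W′|₄
`stub_wildWideApexFourStartsWon`; res-L1-w43-plan-1 RULING 2026-08-27T21:45:42Z (D₃ᴮ lane), hand B (the apex-column regime `hH` of
`surfaceBoundaryNC_of_regimesB`).  [OURS · L1 W4.3 · chain w43 · res-L1-w43-lead-1 g6; def-free; the B-form of res-L1-w43-stub-4's `GraphSurf.DWinsTo.of_twist`
(…NCResSurfGraphTwist); nothing here is a statement of any manuscript; AI-produced, gate-checked, weaker than expert review.]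

THE ONE NON-MECHANICAL POINT OF THE RE-THREAD OF THE APEX-COLUMN REGIME.  The D-form regime re-coordinatises the base plane by a legal twist `R`
(`GraphSurf.baseChange`) and plays on from the twisted state `(R^* b, δ^R)`, `δ^R = (R^* f, E, O)`; in the count-move currency «the successors are literally
the same».  In B-form the composite first move `(R ; Φ, w)` must be B-PERMISSIBLE for `δ` and its successor must be THE TRANSFORM of `δ` — true exactly
when the twist FIXES EVERY BOUNDARY LETTER (`R_l = x_l` for `l ∈ E`), which `baseChange` does (`GraphSurf.baseChange_of_mem_E`): then `(R;Φ)_l = Φ_l` on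
`E ⊇ O` (conditions (P2) (P3) and the straightened letters are those of `Φ`), `(R;Φ)^* f = Φ^*(R^* f)` (condition (P1), the chart transform, the strict
transform), and `ord R^* f = ord f` (the order test of the history) — so `δ.transform (R;Φ) w c i = δ^R.transform Φ w c i` on the nose.

* `strIdx_eq_of_eq_unit_mul_X'` — the straightened letter is determined by any unit-times-letter form (every dimension);
* `isBPermissible_comp_of_twist` — B-permissibility of `(R ; Φ, w)` for `δ` from that of `(Φ, w)` for `δ^R`;
* `Decoration.transform_comp_of_twist` — the transforms agree;
* **`DBWinsTo.of_twist`** — a B-win from `(R^* b, δ^R)` (not itself a target) is a B-win from `(b, δ)`.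
-/

set_option linter.dupNamespace false -- mandated namespace of this single-conjunct summit

noncomputable section

namespace Summit.ResolutionOfSingularities.ResolutionOfSingularities.Theorems

namespace TameFourTupleDrop

open MvPowerSeries Literature.AlgebraicGeometry.Resolution

variable {k : Type} [Field k] {m : ℕ}

/-- **THE STRAIGHTENED LETTER IS DETERMINED BY ANY UNIT-TIMES-LETTER FORM** of the coordinate (every dimension; the three-letter case is
`strIdx_eq_of_eq_unit_mul_X`). -/
theorem strIdx_eq_of_eq_unit_mul_X' {Θ : Fin (m + 1) → MvPowerSeries (Fin (m + 1)) k} {l s : Fin (m + 1)}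
    {u : MvPowerSeries (Fin (m + 1)) k} (hu : constantCoeff u ≠ 0) (h : Θ l = u * X s) : strIdx Θ l = s := by
  classical
  obtain ⟨v, -, hv⟩ := strIdx_spec (Φ := Θ) (l := l) ⟨s, u, hu, h⟩
  by_contra hne
  have hdvd : (X (strIdx Θ l) : MvPowerSeries (Fin (m + 1)) k) ∣ Θ l := hv ▸ Dvd.intro_left v rfl
  rw [X_dvd_iff] at hdvd
  have h0 := hdvd (Finsupp.single s 1) (by rw [Finsupp.single_apply, if_neg (Ne.symm hne)])
  rw [h, X, coeff_mul_monomial, if_pos le_rfl, tsub_self, mul_one, coeff_zero_eq_constantCoeff] at h0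
  exact hu h0

/-- New letters depend on the move only through the straightened letters of the old ones. -/
theorem Decoration.newLetters_congr {S : Finset (Fin (m + 1))} {Ψ Φ : Fin (m + 1) → MvPowerSeries (Fin (m + 1)) k}
    (h : ∀ l ∈ S, strIdx Ψ l = strIdx Φ l) (c : Fin (m + 1) → k) (i : Fin (m + 1)) :
    Decoration.newLetters S Ψ c i = Decoration.newLetters S Φ c i := by
  classical
  unfold Decoration.newLetters
  ext x
  simp only [Finset.mem_image, Finset.mem_filter]
  constructor
  · rintro ⟨l, ⟨hlS, hc⟩, rfl⟩
    exact ⟨l, ⟨hlS, by rwa [← h l hlS]⟩, by rw [h l hlS]⟩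
  · rintro ⟨l, ⟨hlS, hc⟩, rfl⟩
    exact ⟨l, ⟨hlS, by rwa [h l hlS]⟩, by rw [h l hlS]⟩

section Twist

variable {δ δ' : Decoration k m} {R Φ : Fin (m + 1) → MvPowerSeries (Fin (m + 1)) k} {w : Fin (m + 1) → ℕ}

/-- On a boundary letter the composite `(R ; Φ)` is `Φ`. -/
theorem comp_apply_of_eq_X (hΦ0 : ∀ i, constantCoeff (Φ i) = 0) {l : Fin (m + 1)} (hRl : R l = X l) :
    (fun i => subst Φ (R i)) l = Φ l := by
  simp only [hRl]
  exact subst_X (hasSubst_of_constantCoeff_zero hΦ0) l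

/-- **B-PERMISSIBILITY OF THE COMPOSITE MOVE `(R ; Φ, w)` FOR `δ`** from that of `(Φ, w)` for the twisted decoration `δ^R = (R^* f, E, O)`, when the legal
twist `R` fixes every boundary letter. -/
theorem isBPermissible_comp_of_twist (hR0 : ∀ i, constantCoeff (R i) = 0)
    (hRdet : IsUnit (Matrix.det (Matrix.of fun i j : Fin (m + 1) => coeff (Finsupp.single j 1) (R i))))
    (hRE : ∀ l ∈ δ.E, R l = X l) (hf : δ'.f = subst R δ.f) (hE : δ'.E = δ.E) (hO : δ'.O = δ.O) (hperm : IsBPermissible δ' Φ w) :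
    IsBPermissible δ (fun i => subst Φ (R i)) w := by
  obtain ⟨hmv, hP1, hP2, hP3⟩ := hperm
  have hΦ0 := hmv.1
  have hcomp : subst (fun i => subst Φ (R i)) δ.f = subst Φ δ'.f := by
    rw [hf, subst_comp_subst_apply (hasSubst_of_constantCoeff_zero hR0) (hasSubst_of_constantCoeff_zero hΦ0)]
  refine ⟨isCountMove_comp hR0 hRdet hmv, ?_, ?_, ?_⟩
  · rw [hcomp]; exact hP1
  · intro l hl
    rw [comp_apply_of_eq_X hΦ0 (hRE l (δ.O_subset hl))]
    exact hP2 l (hO ▸ hl)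
  · intro l hl
    obtain ⟨l', u, hu, hul⟩ := hP3 l (hE ▸ hl)
    exact ⟨l', u, hu, by rw [comp_apply_of_eq_X hΦ0 (hRE l hl)]; exact hul⟩

/-- **THE TRANSFORMS AGREE**: `δ.transform (R ; Φ) w c i = δ^R.transform Φ w c i` for a legal twist fixing the boundary letters and a move `(Φ, w)` that is
B-permissible for `δ^R` (only its letter-straightening (P3) and the legality of `Φ` are used). -/
theorem Decoration.transform_comp_of_twist (hR0 : ∀ i, constantCoeff (R i) = 0)
    (hRdet : IsUnit (Matrix.det (Matrix.of fun i j : Fin (m + 1) => coeff (Finsupp.single j 1) (R i))))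
    (hRE : ∀ l ∈ δ.E, R l = X l) (hf : δ'.f = subst R δ.f) (hE : δ'.E = δ.E) (hO : δ'.O = δ.O) (hperm : IsBPermissible δ' Φ w)
    (c : Fin (m + 1) → k) (i : Fin (m + 1)) :
    δ.transform (fun i => subst Φ (R i)) w c i = δ'.transform Φ w c i := by
  classical
  have hΦ0 := hperm.1.1
  have hcomp : subst (fun i => subst Φ (R i)) δ.f = subst Φ δ'.f := by
    rw [hf, subst_comp_subst_apply (hasSubst_of_constantCoeff_zero hR0) (hasSubst_of_constantCoeff_zero hΦ0)]
  have hstrict : δ.strict (fun i => subst Φ (R i)) w c i = δ'.strict Φ w c i := by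
    simp only [Decoration.strict, Decoration.fChart, hcomp]
  have ho : δ.o = δ'.o := by
    rw [Decoration.o, Decoration.o, hf, NCTransport.order_subst_of_isUnit_det hR0 hRdet]
  have hidx : ∀ l ∈ δ.E, strIdx (fun i => subst Φ (R i)) l = strIdx Φ l := by
    intro l hl
    obtain ⟨l', u, hu, hul⟩ := hperm.2.2.2 l (hE ▸ hl)
    have hul' : (fun i => subst Φ (R i)) l = u * X l' := by rw [comp_apply_of_eq_X hΦ0 (hRE l hl)]; exact hul
    rw [strIdx_eq_of_eq_unit_mul_X' hu hul, strIdx_eq_of_eq_unit_mul_X' hu hul']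
  have hnewE : Decoration.newLetters δ.E (fun i => subst Φ (R i)) c i = Decoration.newLetters δ'.E Φ c i := by
    rw [hE]; exact Decoration.newLetters_congr hidx c i
  have hnewO : Decoration.newLetters δ.O (fun i => subst Φ (R i)) c i = Decoration.newLetters δ'.O Φ c i := by
    rw [hO]; exact Decoration.newLetters_congr (fun l hl => hidx l (δ.O_subset hl)) c i
  refine Decoration.eq_of_parts ?_ ?_ ?_
  · rw [Decoration.transform_f, Decoration.transform_f, hstrict]
  · rw [Decoration.transform_E, Decoration.transform_E, hnewE]
  · by_cases hlt : ((sqfRep (δ.strict (fun i => subst Φ (R i)) w c i)).order).toNat < δ.o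
    · rw [Decoration.transform_O_of_lt _ _ _ _ _ hlt, Decoration.transform_O_of_lt _ _ _ _ _ (by rw [← hstrict, ← ho]; exact hlt), hnewE]
    · rw [Decoration.transform_O_of_not_lt _ _ _ _ _ hlt, Decoration.transform_O_of_not_lt _ _ _ _ _ (by rw [← hstrict, ← ho]; exact hlt),
        hnewO]

/-- **A B-WIN FROM THE TWISTED POSITION IS A B-WIN FROM THE POSITION** (OURS · L1 W4.3; the B-form of `GraphSurf.DWinsTo.of_twist`).  If the twisted
state `(R^* b, δ^R)` B-wins towards `Q` and is not itself a target, for a legal twist `R` fixing every boundary letter of `δ`, then `(b, δ)` B-wins towards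
`Q`: play `(R ; Φ, w)` where `(R^* b, δ^R)` plays `(Φ, w)` — it is B-permissible for `δ` and its decorated successors are literally the same. -/
theorem DBWinsTo.of_twist {Q : MvPowerSeries (Fin (m + 1)) k × Decoration k m → Prop} {b : MvPowerSeries (Fin (m + 1)) k}
    (hR0 : ∀ i, constantCoeff (R i) = 0)
    (hRdet : IsUnit (Matrix.det (Matrix.of fun i j : Fin (m + 1) => coeff (Finsupp.single j 1) (R i))))
    (hRE : ∀ l ∈ δ.E, R l = X l) (hf : δ'.f = subst R δ.f) (hE : δ'.E = δ.E) (hO : δ'.O = δ.O)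
    (h : DBWinsTo Q (subst R b, δ')) (hQ : ¬ Q (subst R b, δ')) : DBWinsTo Q (b, δ) := by
  classical
  obtain ⟨T, ρ, hT, hσ'⟩ := h
  by_cases hσ : (b, δ) ∈ T
  · exact ⟨T, ρ, hT, hσ⟩
  have hR : HasSubst R := hasSubst_of_constantCoeff_zero hR0
  refine ⟨insert (b, δ) T, fun τ => if τ = (b, δ) then ρ (subst R b, δ') else ρ τ, ?_, Set.mem_insert _ _⟩
  intro τ hτ hQτ
  have hne : ∀ τ' ∈ T, τ' ≠ (b, δ) := fun τ' hτ' h => hσ (h ▸ hτ')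
  rcases Set.mem_insert_iff.mp hτ with rfl | hτT
  · -- the start: twist the move of the twisted state
    obtain ⟨Φ, w, hperm, hcl⟩ := hT _ hσ' hQ
    refine ⟨fun i => subst Φ (R i), w, isBPermissible_comp_of_twist hR0 hRdet hRE hf hE hO hperm, ?_⟩
    intro c hc hc0 A G hfac hG
    have hfac' : subst (CobordantChart.chart w c) (subst Φ (subst R b, δ').1) = X 0 ^ A * G := by
      rw [← hfac, subst_comp_subst_apply hR (hasSubst_of_constantCoeff_zero hperm.1.1) b]
    obtain ⟨i, hi, hτ'T, hlt⟩ := hcl c hc hc0 A G hfac' hG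
    refine ⟨i, hi, ?_⟩
    have htr : ((b, δ) : MvPowerSeries (Fin (m + 1)) k × Decoration k m).2.transform (fun i => subst Φ (R i)) w c i =
        ((subst R b, δ') : MvPowerSeries (Fin (m + 1)) k × Decoration k m).2.transform Φ w c i :=
      Decoration.transform_comp_of_twist hR0 hRdet hRE hf hE hO hperm c i
    rw [htr]
    refine ⟨Set.mem_insert_of_mem _ hτ'T, ?_⟩
    simp only [if_neg (hne _ hτ'T), ↓reduceIte]
    exact hlt
  · obtain ⟨Φ, w, hperm, hcl⟩ := hT τ hτT hQτ
    refine ⟨Φ, w, hperm, hcl.mono fun τ' => ?_⟩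
    rintro ⟨hτ'T, hlt⟩
    refine ⟨Set.mem_insert_of_mem _ hτ'T, ?_⟩
    simp only [if_neg (hne τ' hτ'T), if_neg (hne τ hτT)]
    exact hlt

end Twist

end TameFourTupleDrop

end Summit.ResolutionOfSingularities.ResolutionOfSingularities.Theorems

end
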